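import Summits.CriticalPhenomena.PercolationContinuityZ3.Theorems.FK.ClusterCountChernoff
import Summits.CriticalPhenomena.PercolationContinuityZ3.Theorems.FK.PressureQDerivatives
import Summits.CriticalPhenomena.PercolationContinuityZ3.Theorems.FK.RandomClusterEdgeDensityLargeDeviations
import HarnessLib

/-!
# LARGE DEVIATIONS OF THE NUMBER OF CLUSTERS OF THE RANDOM-CLUSTER MODEL, II: `ℤ^d` BOXES — THE LD UPPER BOUND WITH THE `q`-PRESSURE
# AND THE EXPONENTIAL ABSENCE OF CLUSTER DENSITIES ABOVE `κ⁰(p,q)` OR BELOW `κ¹(p,q)` (Grimmett 2006 Thm. (4.58), Lemma (4.79),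
# (4.80)–(4.84); Ellis 2006 Thm. II.6.1 (b), Thm. II.6.3)

Claimed R42 (8)(c) in the cell INBOX at 2026-08-29T14:03:36Z by fkp-10a gen 360 (NEW CLAIM #7 of the gen), addressed to coordinator fk-4 gen 299 (seated 12:03Z 2026-08-29; R182–R186 in force; rulings R187 (claim #6) / R188 requested); lineage row FO-10a-g360k (self-suggested), package g360-clusterld, label CL-B.
Helper file of the `fk-continuity` build cell (bschramm lane; `--supports stmt-CriticalPhenomena-4575`; fkp-10a gen 360,
package g360-clusterld, label CL-B); builds on p205010 (kernel theorem, internal audit signed; external expert review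
pending). No definitions, no named facts, no sorries; standard axioms.
UNCONDITIONAL (`d ≥ 1`, `0 < p < 1`, `q ≥ 1` for the LD bounds and `q > 1` for the tails; `Λ_N = {−N,…,N}^d` with the free (`b = false`) or
wired (`b = true`) boundary condition `boxBC d b N`; `k^b_N` = `clusterCount · (boxBC d b N)`; `κ^b(p,q) = φ^b_{p,q}(|C_0|⁻¹) =
∫ |C_0|⁻¹ d(rcLimit d b p q)` the cluster densities; `Ψ` = ANY `q`-pressure function of `p`, `|Λ_N|⁻¹ log Z^b_{Λ_N}(p,y) → Ψ(y)` for
`y ≥ 1` and both `b` (exists: `exists_rcPressure_q`; its one-sided derivatives `Ψ'(q+) = κ⁰(p,q)/q`, `Ψ'(q−) = κ¹(p,q)/q` are the tree's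
`hasDerivWithinAt_pressure_q_Ioi` / `_Iio`)).
Scope: volume-order UPPER large-deviation bounds for the number of clusters under the box measures; nothing at or about `p_c(q)`, no
LD lower bound, no statement about FH / TP_FK; nothing percolation-bearing.

* `exists_rcPressure_q` — a `q`-pressure function exists (choice over the tree's thermodynamic limit);
* **`cl_ld_upper_box`** / **`cl_ld_lower_box`** — for `1 ≤ q ≤ q'` resp. `1 ≤ q' ≤ q`, `s = log(q'/q)`, every `m`, `ε > 0`, both `b`:
  eventually `φ^b_{Λ_N,p,q}{m|Λ_N| ≤ k^b_N} ≤ exp(−|Λ_N|(sm − (Ψ(q') − Ψ(q)) − ε))` resp. the same for `{k^b_N ≤ m|Λ_N|}`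
  (Ellis' Thm. II.6.1 (b) for half-lines, from the Chernoff bounds of file I and the thermodynamic limit);
* `hasDerivWithinAt_clusterRate`, **`exists_clusterRate_pos_of_gt`** / **`exists_clusterRate_pos_of_lt`** — for `q > 1`: above `κ⁰(p,q)`
  some upper rate is positive, below `κ¹(p,q)` some lower rate is positive (one-sided `q`-derivatives of the pressure);
* **`cl_upper_tail_exp_decay`** / **`cl_lower_tail_exp_decay`** — NO CLUSTER DENSITY ABOVE `κ⁰(p,q)` OR BELOW `κ¹(p,q)` AT VOLUME ORDER:
  for `q > 1`, `κ⁰(p,q) < m` ⇒ `∃ c > 0, ∀ b, ∀ᶠ N, φ^b_{Λ_N,p,q}{m|Λ_N| ≤ k^b_N} ≤ e^{−c|Λ_N|}`, and the mirror below `κ¹(p,q)`.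

## References

* G. Grimmett, *The Random-Cluster Model*, Springer (2006), §4.5 Thm. (4.58), Lemma (4.79), (4.80)–(4.84). [Grimmett2006]
* R. S. Ellis, *Entropy, Large Deviations, and Statistical Mechanics*, Springer (2006), Thm. II.6.1 (b), Thm. II.6.3. [Ellis2006]
-/

noncomputable section

namespace Summit.CriticalPhenomena.PercolationContinuityZ3.Theorems.FK

namespace RandomClusterLargeDeviations

open Finset Filter Topology Set MeasureTheory
open Literature.Probability.LatticeModels Literature.Probability.Percolation

variable {d : ℕ} {p : ℝ} {Ψ : ℝ → ℝ}

/-! ### A `q`-pressure function -/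

/-- **A `q`-PRESSURE FUNCTION EXISTS**: for `0 ≤ p ≤ 1` there is `Ψ : ℝ → ℝ` with `|Λ_N|⁻¹ log Z^b_{Λ_N}(p,y) → Ψ(y)` for every `y ≥ 1`
and both boundary conditions (the tree's thermodynamic limit, chosen pointwise). [cite: Grimmett2006, Thm. (4.58)] -/
theorem exists_rcPressure_q (d : ℕ) (hp : p ∈ Set.Icc (0 : ℝ) 1) :
    ∃ Ψ : ℝ → ℝ, ∀ y : ℝ, 1 ≤ y → ∀ b : Bool, Tendsto (fun N : ℕ =>
      Real.log (rcPartitionFunction (finsetGraph (zdGraph d) (box d N)) p y (boxBC d b N)) / #(box d N)) atTop (𝓝 (Ψ y)) := by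
  classical
  have h : ∀ y : ℝ, ∃ Ψy : ℝ, 1 ≤ y → ∀ b : Bool, Tendsto (fun N : ℕ =>
      Real.log (rcPartitionFunction (finsetGraph (zdGraph d) (box d N)) p y (boxBC d b N)) / #(box d N)) atTop (𝓝 Ψy) := by
    intro y
    by_cases hy : 1 ≤ y
    · obtain ⟨Ψy, -, hΨy⟩ := exists_forall_tendsto_log_rcPartitionFunction_box_div d hp hy
      exact ⟨Ψy, fun _ => hΨy⟩
    · exact ⟨0, fun h => (hy h).elim⟩
  choose Ψ hΨ using h
  exact ⟨Ψ, hΨ⟩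

/-! ### The LD upper bounds on boxes -/

/-- **LD UPPER BOUND, UPPER TAIL OF THE CLUSTER COUNT** (`1 ≤ q ≤ q'`, `s = log(q'/q) ≥ 0`): for every `m`, `ε > 0` and both
boundary conditions, eventually `φ^b_{Λ_N,p,q}{m|Λ_N| ≤ k^b_N} ≤ exp(−|Λ_N|(sm − (Ψ(q') − Ψ(q)) − ε))`.
[cite: Ellis2006, Thm. II.6.1 (b); Grimmett2006, Thm. (4.58)] -/
theorem cl_ld_upper_box {q q' : ℝ} (hp : p ∈ Set.Ioo (0 : ℝ) 1) (hq : 1 ≤ q) (hqq' : q ≤ q')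
    (hΨ : ∀ y : ℝ, 1 ≤ y → ∀ b : Bool, Tendsto (fun N : ℕ =>
      Real.log (rcPartitionFunction (finsetGraph (zdGraph d) (box d N)) p y (boxBC d b N)) / #(box d N)) atTop (𝓝 (Ψ y)))
    (m : ℝ) {ε : ℝ} (hε : 0 < ε) (b : Bool) :
    ∀ᶠ N : ℕ in atTop,
      (rcMeasure (finsetGraph (zdGraph d) (box d N)) p q (boxBC d b N)).real
          {η : BondConfig ↥(box d N) | m * #(box d N) ≤ (clusterCount η (boxBC d b N) : ℝ)} ≤
        Real.exp (-(#(box d N) * (Real.log (q' / q) * m - (Ψ q' - Ψ q) - ε))) := by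
  have hq0 : 0 < q := one_pos.trans_le hq
  have hlim := (hΨ q' (hq.trans hqq') b).sub (hΨ q hq b)
  have hev : ∀ᶠ N : ℕ in atTop,
      Real.log (rcPartitionFunction (finsetGraph (zdGraph d) (box d N)) p q' (boxBC d b N)) / #(box d N) -
        Real.log (rcPartitionFunction (finsetGraph (zdGraph d) (box d N)) p q (boxBC d b N)) / #(box d N) < Ψ q' - Ψ q + ε :=
    hlim.eventually (gt_mem_nhds (by linarith))
  filter_upwards [hev] with N hN
  have hV : (0 : ℝ) < #(box d N) := by exact_mod_cast (box_nonempty d N).card_pos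
  refine (rcMeasure_real_le_clusterCount_le _ hp hq0 hqq' (boxBC d b N) (m * #(box d N))).trans ?_
  rw [Real.exp_le_exp, ← sub_div, div_lt_iff₀ hV] at *
  nlinarith [hN]

/-- **LD UPPER BOUND, LOWER TAIL OF THE CLUSTER COUNT** (`1 ≤ q' ≤ q`, `s = log(q'/q) ≤ 0`): eventually
`φ^b_{Λ_N,p,q}{k^b_N ≤ m|Λ_N|} ≤ exp(−|Λ_N|(sm − (Ψ(q') − Ψ(q)) − ε))`. [cite: Ellis2006, Thm. II.6.1 (b); Grimmett2006, Thm. (4.58)] -/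
theorem cl_ld_lower_box {q q' : ℝ} (hp : p ∈ Set.Ioo (0 : ℝ) 1) (hq' : 1 ≤ q') (hqq' : q' ≤ q)
    (hΨ : ∀ y : ℝ, 1 ≤ y → ∀ b : Bool, Tendsto (fun N : ℕ =>
      Real.log (rcPartitionFunction (finsetGraph (zdGraph d) (box d N)) p y (boxBC d b N)) / #(box d N)) atTop (𝓝 (Ψ y)))
    (m : ℝ) {ε : ℝ} (hε : 0 < ε) (b : Bool) :
    ∀ᶠ N : ℕ in atTop,
      (rcMeasure (finsetGraph (zdGraph d) (box d N)) p q (boxBC d b N)).real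
          {η : BondConfig ↥(box d N) | (clusterCount η (boxBC d b N) : ℝ) ≤ m * #(box d N)} ≤
        Real.exp (-(#(box d N) * (Real.log (q' / q) * m - (Ψ q' - Ψ q) - ε))) := by
  have hq'0 : 0 < q' := one_pos.trans_le hq'
  have hlim := (hΨ q' hq' b).sub (hΨ q (hq'.trans hqq') b)
  have hev : ∀ᶠ N : ℕ in atTop,
      Real.log (rcPartitionFunction (finsetGraph (zdGraph d) (box d N)) p q' (boxBC d b N)) / #(box d N) -
        Real.log (rcPartitionFunction (finsetGraph (zdGraph d) (box d N)) p q (boxBC d b N)) / #(box d N) < Ψ q' - Ψ q + ε :=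
    hlim.eventually (gt_mem_nhds (by linarith))
  filter_upwards [hev] with N hN
  have hV : (0 : ℝ) < #(box d N) := by exact_mod_cast (box_nonempty d N).card_pos
  refine (rcMeasure_real_clusterCount_le_le _ hp hq'0 hqq' (boxBC d b N) (m * #(box d N))).trans ?_
  rw [Real.exp_le_exp, ← sub_div, div_lt_iff₀ hV] at *
  nlinarith [hN]

/-! ### Positive rates from the one-sided `q`-derivatives of the pressure -/

/-- The derivative of the rate `y ↦ log(y/q)·m − (Ψ(y) − Ψ(q))` within `s` at `q > 0` is `m/q − Ψ'`. [folklore] -/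
theorem hasDerivWithinAt_clusterRate {s : Set ℝ} {q D : ℝ} (hq : 0 < q) (hD : HasDerivWithinAt Ψ D s q) (m : ℝ) :
    HasDerivWithinAt (fun y => Real.log (y / q) * m - (Ψ y - Ψ q)) (q⁻¹ * m - D) s q := by
  have h1 : HasDerivAt (fun y : ℝ => Real.log (y / q)) q⁻¹ q := by
    have h := ((hasDerivAt_id q).div_const q).log (by rw [id, div_self hq.ne']; exact one_ne_zero)
    rw [id, div_self hq.ne', div_one, one_div] at h
    exact h
  exact (h1.hasDerivWithinAt.mul_const m).sub (hD.sub_const (Ψ q))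

/-- **SOME UPPER RATE IS POSITIVE ABOVE `κ⁰(p,q)`** (`q > 1`, `Ψ'(q+) = κ⁰(p,q)/q`): if `κ⁰(p,q) < m` then for some `q' ∈ (q, q+1)`,
`0 < log(q'/q)·m − (Ψ(q') − Ψ(q))`. [cite: Grimmett2006, (4.84); Ellis2006, Thm. II.6.3 (proof)] -/
theorem exists_clusterRate_pos_of_gt (hd : 0 < d) (hp : p ∈ Set.Ioo (0 : ℝ) 1) {q : ℝ} (hq : 1 < q)
    (hΨ : ∀ y : ℝ, 1 ≤ y → ∀ b : Bool, Tendsto (fun N : ℕ =>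
      Real.log (rcPartitionFunction (finsetGraph (zdGraph d) (box d N)) p y (boxBC d b N)) / #(box d N)) atTop (𝓝 (Ψ y)))
    {m : ℝ} (hm : ∫ ω, ((openCluster ω (0 : Site d)).ncard : ℝ)⁻¹ ∂(rcLimit d false p q) < m) :
    ∃ q' ∈ Set.Ioo q (q + 1), 0 < Real.log (q' / q) * m - (Ψ q' - Ψ q) := by
  have hq0 : 0 < q := one_pos.trans hq
  have hΨ' : ∀ b : Bool, ∀ᶠ y in 𝓝 q, Tendsto (fun N : ℕ =>
      Real.log (rcPartitionFunction (finsetGraph (zdGraph d) (box d N)) p y (boxBC d b N)) / #(box d N)) atTop (𝓝 (Ψ y)) :=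
    fun b => (eventually_gt_nhds hq).mono fun y hy => hΨ y hy.le b
  have hD := hasDerivWithinAt_pressure_q_Ioi hd hp hq.le hΨ'
  have hR := hasDerivWithinAt_clusterRate hq0 hD m
  have hpos : 0 < q⁻¹ * m - (∫ ω, ((openCluster ω (0 : Site d)).ncard : ℝ)⁻¹ ∂(rcLimit d false p q)) / q := by
    rw [div_eq_inv_mul, ← mul_sub]
    exact mul_pos (inv_pos.2 hq0) (sub_pos.2 hm)
  exact exists_Ioo_pos_of_hasDerivWithinAt_Ioi hR hpos (by rw [div_self hq0.ne', Real.log_one, zero_mul, sub_self, sub_zero])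
    (lt_add_one q)

/-- **SOME LOWER RATE IS POSITIVE BELOW `κ¹(p,q)`** (`q > 1`, `Ψ'(q−) = κ¹(p,q)/q`): if `m < κ¹(p,q)` then for some `q' ∈ (1, q)`,
`0 < log(q'/q)·m − (Ψ(q') − Ψ(q))` (`log(q'/q) < 0`). [cite: Grimmett2006, (4.84); Ellis2006, Thm. II.6.3 (proof)] -/
theorem exists_clusterRate_pos_of_lt (hd : 0 < d) (hp : p ∈ Set.Ioo (0 : ℝ) 1) {q : ℝ} (hq : 1 < q)
    (hΨ : ∀ y : ℝ, 1 ≤ y → ∀ b : Bool, Tendsto (fun N : ℕ =>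
      Real.log (rcPartitionFunction (finsetGraph (zdGraph d) (box d N)) p y (boxBC d b N)) / #(box d N)) atTop (𝓝 (Ψ y)))
    {m : ℝ} (hm : m < ∫ ω, ((openCluster ω (0 : Site d)).ncard : ℝ)⁻¹ ∂(rcLimit d true p q)) :
    ∃ q' ∈ Set.Ioo 1 q, 0 < Real.log (q' / q) * m - (Ψ q' - Ψ q) := by
  have hq0 : 0 < q := one_pos.trans hq
  have hΨ' : ∀ b : Bool, ∀ᶠ y in 𝓝 q, Tendsto (fun N : ℕ =>
      Real.log (rcPartitionFunction (finsetGraph (zdGraph d) (box d N)) p y (boxBC d b N)) / #(box d N)) atTop (𝓝 (Ψ y)) :=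
    fun b => (eventually_gt_nhds hq).mono fun y hy => hΨ y hy.le b
  have hD := hasDerivWithinAt_pressure_q_Iio hd hp hq hΨ'
  have hR := hasDerivWithinAt_clusterRate hq0 hD m
  have hneg : q⁻¹ * m - (∫ ω, ((openCluster ω (0 : Site d)).ncard : ℝ)⁻¹ ∂(rcLimit d true p q)) / q < 0 := by
    rw [div_eq_inv_mul, ← mul_sub]
    exact mul_neg_of_pos_of_neg (inv_pos.2 hq0) (sub_neg.2 hm)
  exact exists_Ioo_pos_of_hasDerivWithinAt_Iio hR hneg (by rw [div_self hq0.ne', Real.log_one, zero_mul, sub_self, sub_zero]) hq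

/-! ### No cluster density above `κ⁰` or below `κ¹` at volume order -/

/-- **NO CLUSTER DENSITY ABOVE `κ⁰(p,q)` AT VOLUME ORDER** (`d ≥ 1`, `0 < p < 1`, `q > 1`): if `κ⁰(p,q) < m` then there is `c > 0` such
that, for BOTH boundary conditions, eventually `φ^b_{Λ_N,p,q}{m|Λ_N| ≤ k^b_N} ≤ e^{−c|Λ_N|}`.
[cite: Ellis2006, Thm. II.6.1 (b) and Thm. II.6.3; Grimmett2006, Thm. (4.58), (4.84)] -/
theorem cl_upper_tail_exp_decay (hd : 0 < d) (hp : p ∈ Set.Ioo (0 : ℝ) 1) {q : ℝ} (hq : 1 < q) {m : ℝ}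
    (hm : ∫ ω, ((openCluster ω (0 : Site d)).ncard : ℝ)⁻¹ ∂(rcLimit d false p q) < m) :
    ∃ c : ℝ, 0 < c ∧ ∀ b : Bool, ∀ᶠ N : ℕ in atTop,
      (rcMeasure (finsetGraph (zdGraph d) (box d N)) p q (boxBC d b N)).real
          {η : BondConfig ↥(box d N) | m * #(box d N) ≤ (clusterCount η (boxBC d b N) : ℝ)} ≤ Real.exp (-(c * #(box d N))) := by
  obtain ⟨Ψ, hΨ⟩ := exists_rcPressure_q d (p := p) ⟨hp.1.le, hp.2.le⟩
  obtain ⟨q', hq', hrate⟩ := exists_clusterRate_pos_of_gt hd hp hq hΨ hm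
  refine ⟨(Real.log (q' / q) * m - (Ψ q' - Ψ q)) / 2, half_pos hrate, fun b => ?_⟩
  filter_upwards [cl_ld_upper_box hp hq.le hq'.1.le hΨ m (half_pos hrate) b] with N hN
  refine hN.trans (le_of_eq ?_)
  congr 1
  ring

/-- **NO CLUSTER DENSITY BELOW `κ¹(p,q)` AT VOLUME ORDER** (`q > 1`): if `m < κ¹(p,q)` then there is `c > 0` such that, for both boundary
conditions, eventually `φ^b_{Λ_N,p,q}{k^b_N ≤ m|Λ_N|} ≤ e^{−c|Λ_N|}`. [cite: Ellis2006, Thm. II.6.1 (b) and Thm. II.6.3; Grimmett2006, Thm. (4.58), (4.84)] -/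
theorem cl_lower_tail_exp_decay (hd : 0 < d) (hp : p ∈ Set.Ioo (0 : ℝ) 1) {q : ℝ} (hq : 1 < q) {m : ℝ}
    (hm : m < ∫ ω, ((openCluster ω (0 : Site d)).ncard : ℝ)⁻¹ ∂(rcLimit d true p q)) :
    ∃ c : ℝ, 0 < c ∧ ∀ b : Bool, ∀ᶠ N : ℕ in atTop,
      (rcMeasure (finsetGraph (zdGraph d) (box d N)) p q (boxBC d b N)).real
          {η : BondConfig ↥(box d N) | (clusterCount η (boxBC d b N) : ℝ) ≤ m * #(box d N)} ≤ Real.exp (-(c * #(box d N))) := by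
  obtain ⟨Ψ, hΨ⟩ := exists_rcPressure_q d (p := p) ⟨hp.1.le, hp.2.le⟩
  obtain ⟨q', hq', hrate⟩ := exists_clusterRate_pos_of_lt hd hp hq hΨ hm
  refine ⟨(Real.log (q' / q) * m - (Ψ q' - Ψ q)) / 2, half_pos hrate, fun b => ?_⟩
  filter_upwards [cl_ld_lower_box hp hq'.1.le hq'.2.le hΨ m (half_pos hrate) b] with N hN
  refine hN.trans (le_of_eq ?_)
  congr 1
  ring

end RandomClusterLargeDeviations

end Summit.CriticalPhenomena.PercolationContinuityZ3.Theorems.FK
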